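import Summits.ValiantsHypothesis.ValiantsHypothesis.Theorems.EquivariantDialLayersQuadricTypes
import HarnessLib

/-!
# Isotypic kill lemma and the Pieri depth window (support for `EquivariantDialLayers`, degree `d ≥ 3`)

Support statements only (lane `--supports`); nothing here closes a route item; the leaf `IdealWidthSuperpoly` is
untouched. File R1 of the «block-witness apolar bound» programme (representation-theoretic half of its survivor lemma).
* §1 `isotypicProj_eq_zero_of_forall_sum_subgroup_eq_zero` (any finite `G`): if `∑_{h ∈ F} χ(h) ≠ 0` for an
  irreducible `χ` and a subgroup `F`, and the `F`-symmetriser kills EVERY translate of `u`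
  (`∑_{h ∈ F} ρ(h)ρ(g)u = 0`), then `P_χ u = 0` (the cyclic subrepresentation `U = ℂG·P_χu ⊆ V_χ` has `U^F = 0`
  while `dim(U_χ ∩ U^F) = ⟨χ, χ_U⟩·|F|⁻¹∑_F χ`); also along an injective hom. Opposite regime to
  `EquivariantDialLayersQuadricTypes.isotypicProj_eq_zero_of_sum_eq_zero` (`∑_N χ = 0`, `u` fixed).
* §2 Pieri depth window for `1 × 𝔖_b ≤ 𝔖_a × 𝔖_b ≤ 𝔖_m` (`e : Fin a ⊕ Fin b ≃ Fin m`):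
  `∑_{𝔖_b} χ^λ(1 × ρ) ≠ 0 ⟹ λ₁ ≥ m - a` (`le_getD_add_of_sum_ne_zero`) and conversely for `2a ≤ m`
  (`sum_ne_zero_of_le_getD_add`, witness `π' = (λ₂ + t, λ₃, …) ⊢ a`, `t = λ₁ + a - m`); the sum is a natural number.
* §3 `ρ` a representation of `𝔖_m × 𝔖_m`, `χ = χ^λ ⊠ χ^μ`: `λ₁ ≥ m - a` and a row Young symmetriser over `1 × 𝔖_b`
  killing every translate of `u` force `P_χ u = 0` (`boxProd_isotypicProj_eq_zero_of_row/col`; depth corollary).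
-/

set_option linter.dupNamespace false

namespace Summit.ValiantsHypothesis.ValiantsHypothesis.Theorems.EquivariantDialLayersApolarKill

open Equiv (Perm)
open Literature.RepresentationTheory.FiniteGroups Literature.NumberTheory.DiophantineGeometry
open Literature.Computability.AlgebraicComplexity Literature.RingTheory.SymmetricFunctions.SymmPoly
open Summit.ValiantsHypothesis.ValiantsHypothesis.Theorems.EquivariantDialLayersQuadricTypes

/-! ## §1 The kill lemma -/

section Kill

variable {G V : Type} [Group G] [Fintype G] [AddCommGroup V] [Module ℂ V] [FiniteDimensional ℂ V]
  (ρ : Representation ℂ G V)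

omit [Fintype G] [FiniteDimensional ℂ V] in
/-- The cyclic submodule `ℂG · x = span {ρ(g) x}` is `G`-stable. [folklore] -/
theorem apply_mem_span_range_apply (x : V) (g : G) {v : V}
    (hv : v ∈ Submodule.span ℂ (Set.range fun g' : G => ρ g' x)) :
    ρ g v ∈ Submodule.span ℂ (Set.range fun g' : G => ρ g' x) := by
  induction hv using Submodule.span_induction with
  | mem w hw =>
    obtain ⟨g', rfl⟩ := hw
    have : ρ g (ρ g' x) = ρ (g * g') x := by rw [map_mul]; rfl
    rw [this]
    exact Submodule.subset_span ⟨g * g', rfl⟩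
  | zero => rw [map_zero]; exact Submodule.zero_mem _
  | add a b _ _ ha hb => rw [map_add]; exact Submodule.add_mem _ ha hb
  | smul c a _ ha => rw [map_smul]; exact Submodule.smul_mem _ c ha

/-- ★ KILL LEMMA. If `∑_{h ∈ F} χ(h) ≠ 0` (`χ` irreducible, `F` a subgroup) and the `F`-symmetriser kills every
translate of `u` (`∑_{h ∈ F} ρ(h)ρ(g)u = 0` for all `g`), then `P_χ u = 0`: `U = ℂG·P_χu ⊆ V_χ` has `U^F = 0` but
`dim(U_χ ∩ U^F) = ⟨χ, χ_U⟩|F|⁻¹∑_F χ ≠ 0` unless `U = 0`. [cite: SerreLinearRepresentations1977, §2.6 Thm. 8] -/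
theorem isotypicProj_eq_zero_of_forall_sum_subgroup_eq_zero (F : Subgroup G) [Fintype F] {χ : G → ℂ}
    (hχ : IsIrrChar G χ) (hF : ∑ h : F, χ h ≠ 0) {u : V} (hu : ∀ g : G, ∑ h : F, ρ h (ρ g u) = 0) :
    isotypicProj ρ χ u = 0 := by
  classical
  set x := isotypicProj ρ χ u with hx
  set U : Submodule ℂ V := Submodule.span ℂ (Set.range fun g' : G => ρ g' x) with hU
  have hcf : IsClassFun χ := hχ.isCharacter.isClassFun
  -- (1) the `F`-symmetriser kills `U`; (2) `U ⊆ V_χ`; (3) `U` is a subrepresentation with `U^F = 0`, `U_χ = U`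
  have hker : ∀ v ∈ U, (∑ h : F, ρ h) v = 0 := by
    intro v hv
    induction hv using Submodule.span_induction with
    | mem w hw =>
      obtain ⟨g, rfl⟩ := hw
      rw [LinearMap.sum_apply]
      have hcomm : ∀ h : F, ρ h (ρ g x) = isotypicProj ρ χ (ρ h (ρ g u)) := fun h => by
        rw [hx, ← isotypicProj_apply_apply ρ hcf g u, ← isotypicProj_apply_apply ρ hcf]
      simp_rw [hcomm, ← map_sum, hu g, map_zero]
    | zero => exact map_zero _
    | add a b _ _ ha hb => rw [map_add, ha, hb, add_zero]
    | smul c a _ ha => rw [map_smul, ha, smul_zero]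
  have hfix : ∀ v ∈ U, isotypicProj ρ χ v = v := by
    intro v hv
    induction hv using Submodule.span_induction with
    | mem w hw =>
      obtain ⟨g, rfl⟩ := hw
      show isotypicProj ρ χ (ρ g x) = ρ g x
      rw [hx, ← isotypicProj_apply_apply ρ hcf g u]
      exact isotypicProj_isotypicProj_apply ρ hχ _
    | zero => exact map_zero _
    | add a b _ _ ha hb => rw [map_add, ha, hb]
    | smul c a _ ha => rw [map_smul, ha]
  let W : Subrepresentation ρ := ⟨U, fun g _ hv => apply_mem_span_range_apply ρ x g hv⟩
  have hinv : Representation.invariants (W.toRepresentation.comp F.subtype) = ⊥ := by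
    rw [eq_bot_iff]
    intro w hw
    have h1 := sum_subgroup_apply_of_mem_invariants W.toRepresentation hw
    have h2 : (((∑ h : F, W.toRepresentation h) w : ↥W.toSubmodule) : V) = 0 := by
      rw [LinearMap.sum_apply, Submodule.coe_sum]
      have : ∀ h : F, ((W.toRepresentation h w : ↥W.toSubmodule) : V) = ρ h (w : V) := fun h => rfl
      simp_rw [this, ← LinearMap.sum_apply]
      exact hker w w.2
    rw [h1, Submodule.coe_smul] at h2
    exact (Submodule.mem_bot _).2
      (Subtype.ext ((smul_eq_zero.1 h2).resolve_left (Nat.cast_ne_zero.2 Fintype.card_ne_zero)))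
  have htop : LinearMap.range (isotypicProj W.toRepresentation χ) = ⊤ := by
    rw [eq_top_iff]
    rintro w -
    refine ⟨w, Subtype.ext ?_⟩
    rw [Subrepresentation.coe_isotypicProj_apply]
    exact hfix w w.2
  -- (4) dimensions
  have hdim := finrank_range_isotypicProj_inf_invariants W.toRepresentation F hχ
  rw [hinv, inf_bot_eq, finrank_bot, Nat.cast_zero] at hdim
  have hdim2 := finrank_range_isotypicProj W.toRepresentation hχ
  rw [htop, finrank_top] at hdim2
  by_contra hx0
  have hxU : x ∈ W.toSubmodule := Submodule.subset_span ⟨1, by simp⟩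
  have hUne : Module.finrank ℂ ↥W.toSubmodule ≠ 0 := fun h0 => hx0 (by
    rw [Submodule.finrank_eq_zero] at h0; rw [h0, Submodule.mem_bot] at hxU; exact hxU)
  have hcl : classInner χ W.toRepresentation.character ≠ 0 := fun h0 => hUne (by
    rw [h0, mul_zero, Nat.cast_eq_zero] at hdim2; exact hdim2)
  exact mul_ne_zero hcl (mul_ne_zero (inv_ne_zero (Nat.cast_ne_zero.2 Fintype.card_ne_zero)) hF) hdim.symm

/-- The kill lemma along an injective homomorphism `φ : K →* G` (a Young subgroup given as an embedding):
`∑_k χ(φ k) ≠ 0` and `∑_k ρ(φ k) ρ(g) u = 0` for all `g` force `P_χ u = 0`.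
[cite: SerreLinearRepresentations1977, §2.6 Thm. 8] -/
theorem isotypicProj_eq_zero_of_forall_sum_comp_eq_zero {K : Type} [Group K] [Fintype K]
    (φ : K →* G) (hφ : Function.Injective φ) {χ : G → ℂ} (hχ : IsIrrChar G χ) (hF : ∑ k : K, χ (φ k) ≠ 0) {u : V}
    (hu : ∀ g : G, ∑ k : K, ρ (φ k) (ρ g u) = 0) : isotypicProj ρ χ u = 0 := by
  classical
  haveI : Fintype ↥φ.range := Fintype.ofFinite _
  have tr : ∀ {M : Type} [AddCommMonoid M] (f : G → M), ∑ h : ↥φ.range, f h = ∑ k : K, f (φ k) := by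
    intro M _ f
    refine (Fintype.sum_equiv (MonoidHom.ofInjective hφ).toEquiv (fun k => f (φ k)) (fun h => f h)
      fun k => ?_).symm
    simp [MonoidHom.ofInjective_apply]
  refine isotypicProj_eq_zero_of_forall_sum_subgroup_eq_zero ρ φ.range hχ ?_ fun g => ?_
  · rw [tr (fun g => χ g)]; exact hF
  · rw [tr (fun h => ρ h (ρ g u))]; exact hu g

end Kill

/-! ## §2 The Pieri depth window -/

variable {m : ℕ}

/-- VANISHING DIRECTION: `∑_{ρ ∈ 𝔖_b} χ^λ(1 × ρ) ≠ 0` for the Young subgroup `1 × 𝔖_b ≤ 𝔖_m` forces `λ₁ ≥ m - a`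
(Pieri: some `π' ⊢ a` interlaces `λ`, so `λ₂ + λ₃ + ⋯ ≤ |π'| = a`). [cite: BurgisserEtAl2011, Prop. 4.5.4] -/
theorem le_getD_add_of_sum_ne_zero {a b : ℕ} (e : Fin a ⊕ Fin b ≃ Fin m) (la : Nat.Partition m)
    (h : ∑ ρ : Perm (Fin b), spechtCharacter ℂ la (e.permCongr ((1 : Perm (Fin a)).sumCongr ρ)) ≠ 0) :
    m ≤ la.sortedParts.getD 0 0 + a := by
  classical
  have hbm : a + b = m := by have := Fintype.card_congr e; simpa using this
  rw [sum_spechtCharacter_permCongr_sumCongr e la 1] at h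
  obtain ⟨π', hπ', -⟩ := Finset.exists_ne_zero_of_sum_ne_zero (right_ne_zero_of_mul h)
  have hla : ∑ i : Fin (m + 1), la.sortedParts.getD i 0 = m :=
    sum_getD_sortedParts la ((card_parts_le_size' la).trans (Nat.le_succ m))
  have hπ : ∑ i : Fin m, π'.sortedParts.getD i 0 = a :=
    sum_getD_sortedParts π' ((card_parts_le_size' π').trans (by omega))
  rw [Fin.sum_univ_succ] at hla
  simp only [Fin.val_zero, Fin.val_succ] at hla
  have hle : ∑ i : Fin m, la.sortedParts.getD (i + 1) 0 ≤ ∑ i : Fin m, π'.sortedParts.getD i 0 :=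
    Finset.sum_le_sum fun i _ => ((Finset.mem_filter.1 hπ').2 i).2
  omega

/-- The Young-subgroup sum `∑_{ρ ∈ 𝔖_b} χ^λ(1 × ρ) = b! · ∑_{π' interlaced} f^{π'}` is a natural number.
[cite: BurgisserEtAl2011, Prop. 4.5.4] -/
theorem sum_spechtCharacter_sumCongr_eq_natCast {a b : ℕ} (e : Fin a ⊕ Fin b ≃ Fin m) (la : Nat.Partition m) :
    ∃ n : ℕ, ∑ ρ : Perm (Fin b), spechtCharacter ℂ la (e.permCongr ((1 : Perm (Fin a)).sumCongr ρ)) = n := by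
  classical
  rw [sum_spechtCharacter_permCongr_sumCongr e la 1]
  simp_rw [spechtCharacter_one_eq_numStandardTableaux]
  rw [← Nat.cast_sum, ← Nat.cast_mul]
  exact ⟨_, rfl⟩

/-- ★ NON-VANISHING DIRECTION: `λ₁ ≥ m - a` and `2a ≤ m` give `∑_{ρ ∈ 𝔖_b} χ^λ(1 × ρ) ≠ 0` — the partition
`π' = (λ₂ + t, λ₃, λ₄, …) ⊢ a`, `t = λ₁ + a - m`, interlaces `λ` (`π'₁ ≤ λ₁` as `λ₂ + a ≤ 2a ≤ m`), so Pieri's sum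
of `f^{π'} > 0` is non-empty. [cite: BurgisserEtAl2011, Prop. 4.5.4] -/
theorem sum_ne_zero_of_le_getD_add {a b : ℕ} (e : Fin a ⊕ Fin b ≃ Fin m) (la : Nat.Partition m)
    (h2a : 2 * a ≤ m) (h : m ≤ la.sortedParts.getD 0 0 + a) :
    ∑ ρ : Perm (Fin b), spechtCharacter ℂ la (e.permCongr ((1 : Perm (Fin a)).sumCongr ρ)) ≠ 0 := by
  classical
  have hbm : a + b = m := by have := Fintype.card_congr e; simpa using this
  rw [sum_spechtCharacter_permCongr_sumCongr e la 1]
  simp_rw [spechtCharacter_one_eq_numStandardTableaux]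
  rw [← Nat.cast_sum]
  refine mul_ne_zero (by exact_mod_cast (Nat.factorial_pos b).ne') ?_
  rw [Nat.cast_ne_zero]
  -- the parts of `λ`: `λ₁ + (λ₂ + ⋯ + λ_{m+2}) = m`, `λ₂ ≤ m - λ₁ ≤ a`
  have hcard : la.parts.card ≤ m + 1 := (card_parts_le_size' la).trans (Nat.le_succ m)
  have hla : ∑ i : Fin (m + 2), la.sortedParts.getD i 0 = m := sum_getD_sortedParts la (by omega)
  rw [Fin.sum_univ_succ] at hla
  simp only [Fin.val_zero, Fin.val_succ] at hla
  have hla1 := Finset.single_le_sum (f := fun i : Fin (m + 1) => la.sortedParts.getD ((i : ℕ) + 1) 0)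
    (fun _ _ => Nat.zero_le _) (Finset.mem_univ (0 : Fin (m + 1)))
  simp only [Fin.val_zero, zero_add] at hla1
  have hanti : ∀ i j : ℕ, i ≤ j → j < m + 2 → la.sortedParts.getD j 0 ≤ la.sortedParts.getD i 0 :=
    fun i j hij hj => getD_sortedParts_antitone (N := m + 2) la
      (show (⟨i, by omega⟩ : Fin (m + 2)) ≤ ⟨j, hj⟩ from hij)
  -- the interlaced weight `γ = (λ₂ + t, λ₃, …, λ_{m+2}) ∈ ℕ^{m+1}`, `t = λ₁ + a - m`
  set t : ℕ := la.sortedParts.getD 0 0 + a - m with ht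
  let γ : Fin (m + 1) → ℕ := fun i => la.sortedParts.getD ((i : ℕ) + 1) 0 + if i = 0 then t else 0
  have hγ : γ ∈ antitoneWeights (m + 1) a := by
    rw [mem_antitoneWeights]
    refine ⟨?_, fun i j hij => ?_⟩
    · simp only [γ, Finset.sum_add_distrib, Finset.sum_ite_eq', Finset.mem_univ, if_true]
      omega
    · simp only [γ]
      by_cases hi : i = 0
      · subst hi
        by_cases hj : j = 0
        · subst hj; exact le_rfl
        · rw [if_neg hj, if_pos rfl, add_zero, Fin.val_zero]
          exact (hanti 1 _ (by omega) (by omega)).trans (Nat.le_add_right _ _)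
      · have hj : j ≠ 0 := fun h0 => hi (Fin.le_zero_iff.1 (h0 ▸ hij))
        rw [if_neg hi, if_neg hj, add_zero, add_zero]
        exact hanti _ _ (by have := Fin.le_def.1 hij; omega) (by omega)
  obtain ⟨π', hπ'card, hπ'γ⟩ := exists_partition_of_mem_antitoneWeights' hγ
  have hπ'i : ∀ i : Fin (m + 1), π'.sortedParts.getD i 0 = γ i := fun i => congrFun hπ'γ i
  -- `π'` interlaces `λ`, so Pieri's sum of `f^{π'} > 0` is non-empty
  refine (Finset.sum_pos (fun π _ => numStandardTableaux_pos_holds π) ⟨π', ?_⟩).ne'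
  rw [Finset.mem_filter, interlaces_iff_fin la hcard π' hπ'card]
  refine ⟨Finset.mem_univ _, fun i => ⟨?_, fun i' hii' => ?_⟩⟩
  · rw [hπ'i]
    simp only [γ]
    by_cases hi : i = 0
    · subst hi
      rw [if_pos rfl, Fin.val_zero, zero_add]
      omega
    · rw [if_neg hi, add_zero]
      exact hanti _ _ (Nat.le_succ _) (by omega)
  · rw [hπ'i, ← hii']
    exact Nat.le_add_right _ _

/-! ## §3 Box-product kills along a row / column Young subgroup -/

/-- The Young embedding `𝔖_b ↪ 𝔖_m`, `ρ' ↦ e ∘ (1 ⊔ ρ') ∘ e⁻¹` (fixing the `a` points `e(inl _)` pointwise),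
as an injective homomorphism. [folklore] -/
theorem exists_monoidHom_sumCongr {a b : ℕ} (e : Fin a ⊕ Fin b ≃ Fin m) :
    ∃ ψ : Perm (Fin b) →* Perm (Fin m), Function.Injective ψ ∧
      ∀ ρ' : Perm (Fin b), ψ ρ' = e.permCongr ((1 : Perm (Fin a)).sumCongr ρ') := by
  refine ⟨e.permCongrHom.toMonoidHom.comp ((Perm.sumCongrHom (Fin a) (Fin b)).comp (MonoidHom.inr _ _)),
    fun x y hxy => ?_, fun _ => rfl⟩
  simp only [MonoidHom.coe_comp, Function.comp_apply, MulEquiv.coe_toMonoidHom] at hxy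
  exact (Prod.ext_iff.1 (Perm.sumCongrHom_injective (e.permCongrHom.injective hxy))).2

section BoxProd

variable {V : Type} [AddCommGroup V] [Module ℂ V] [FiniteDimensional ℂ V]
  (ρ : Representation ℂ (Perm (Fin m) × Perm (Fin m)) V)

/-- ★ ROW KILL. For `χ = χ^λ ⊠ χ^μ` with `λ₁ ≥ m - a` (`2a ≤ m`): if the row Young symmetriser over `1 × 𝔖_b`
(pointwise stabiliser of the `a` rows `e(inl _)`) kills every translate of `u`, then `P_χ u = 0` (kill lemma;
`∑_{ρ'} χ(ψρ', 1) = (∑_{ρ'} χ^λ(ψρ'))·f^μ ≠ 0` by the Pieri window). [cite: SerreLinearRepresentations1977, §2.6 Thm. 8] -/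
theorem boxProd_isotypicProj_eq_zero_of_row {a b : ℕ} (e : Fin a ⊕ Fin b ≃ Fin m) {la mu : Nat.Partition m}
    (h2a : 2 * a ≤ m) (hla : m ≤ la.sortedParts.getD 0 0 + a) {u : V}
    (hu : ∀ g : Perm (Fin m) × Perm (Fin m),
      ∑ ρ' : Perm (Fin b), ρ (e.permCongr ((1 : Perm (Fin a)).sumCongr ρ'), 1) (ρ g u) = 0) :
    isotypicProj ρ (fun t => spechtCharacter ℂ la t.1 * spechtCharacter ℂ mu t.2) u = 0 := by
  classical
  have hχ := IsIrrChar.boxProd (isIrrChar_spechtCharacter la) (isIrrChar_spechtCharacter mu)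
  obtain ⟨ψ, hψinj, hψ⟩ := exists_monoidHom_sumCongr e
  let φ : Perm (Fin b) →* Perm (Fin m) × Perm (Fin m) := (MonoidHom.inl _ _).comp ψ
  have hφ : ∀ ρ', φ ρ' = (e.permCongr ((1 : Perm (Fin a)).sumCongr ρ'), 1) := fun ρ' => Prod.ext (hψ ρ') rfl
  have hφinj : Function.Injective φ := fun x y hxy => hψinj (congrArg Prod.fst hxy)
  refine isotypicProj_eq_zero_of_forall_sum_comp_eq_zero ρ φ hφinj hχ ?_ fun g => ?_
  · simp_rw [hφ, ← Finset.sum_mul]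
    refine mul_ne_zero (sum_ne_zero_of_le_getD_add e la h2a hla) ?_
    rw [spechtCharacter_one_eq_numStandardTableaux]
    exact_mod_cast (numStandardTableaux_pos_holds mu).ne'
  · simp_rw [hφ]; exact hu g

/-- ★ COLUMN KILL: the same in the second factor (`μ₁ ≥ m - a`, column Young symmetriser over `1 × 𝔖_b`).
[cite: SerreLinearRepresentations1977, §2.6 Thm. 8] -/
theorem boxProd_isotypicProj_eq_zero_of_col {a b : ℕ} (e : Fin a ⊕ Fin b ≃ Fin m) {la mu : Nat.Partition m}
    (h2a : 2 * a ≤ m) (hmu : m ≤ mu.sortedParts.getD 0 0 + a) {u : V}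
    (hu : ∀ g : Perm (Fin m) × Perm (Fin m),
      ∑ ρ' : Perm (Fin b), ρ (1, e.permCongr ((1 : Perm (Fin a)).sumCongr ρ')) (ρ g u) = 0) :
    isotypicProj ρ (fun t => spechtCharacter ℂ la t.1 * spechtCharacter ℂ mu t.2) u = 0 := by
  classical
  have hχ := IsIrrChar.boxProd (isIrrChar_spechtCharacter la) (isIrrChar_spechtCharacter mu)
  obtain ⟨ψ, hψinj, hψ⟩ := exists_monoidHom_sumCongr e
  let φ : Perm (Fin b) →* Perm (Fin m) × Perm (Fin m) := (MonoidHom.inr _ _).comp ψ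
  have hφ : ∀ ρ', φ ρ' = (1, e.permCongr ((1 : Perm (Fin a)).sumCongr ρ')) := fun ρ' => Prod.ext rfl (hψ ρ')
  have hφinj : Function.Injective φ := fun x y hxy => hψinj (congrArg Prod.snd hxy)
  refine isotypicProj_eq_zero_of_forall_sum_comp_eq_zero ρ φ hφinj hχ ?_ fun g => ?_
  · simp_rw [hφ, ← Finset.mul_sum]
    refine mul_ne_zero ?_ (sum_ne_zero_of_le_getD_add e mu h2a hmu)
    rw [spechtCharacter_one_eq_numStandardTableaux]
    exact_mod_cast (numStandardTableaux_pos_holds la).ne'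
  · simp_rw [hφ]; exact hu g

/-- SURVIVORS ARE DEEP: if a row Young symmetriser fixing `a + 1` rows pointwise kills every translate of `u`
(`2(a+1) ≤ m`) and `P_{χ^λ ⊠ χ^μ} u ≠ 0`, then the depth `m - λ₁` is at least `a + 1` (columns: symmetric).
[cite: SerreLinearRepresentations1977, §2.6 Thm. 8] -/
theorem getD_add_lt_of_isotypicProj_ne_zero_of_row {a b : ℕ} (e : Fin (a + 1) ⊕ Fin b ≃ Fin m)
    {la mu : Nat.Partition m} (h2a : 2 * (a + 1) ≤ m) {u : V}
    (hu : ∀ g : Perm (Fin m) × Perm (Fin m),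
      ∑ ρ' : Perm (Fin b), ρ (e.permCongr ((1 : Perm (Fin (a + 1))).sumCongr ρ'), 1) (ρ g u) = 0)
    (hne : isotypicProj ρ (fun t => spechtCharacter ℂ la t.1 * spechtCharacter ℂ mu t.2) u ≠ 0) :
    la.sortedParts.getD 0 0 + (a + 1) < m :=
  lt_of_not_ge fun hle => hne (boxProd_isotypicProj_eq_zero_of_row ρ e h2a hle hu)

end BoxProd

end Summit.ValiantsHypothesis.ValiantsHypothesis.Theorems.EquivariantDialLayersApolarKill
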